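import Mathlib
import HarnessLib
import Summits.Ventures.LatticeQCDFlow.Exactness.FlowSamplerTranslationCovariance
import Summits.Ventures.LatticeQCDFlow.Exactness.SUNStoutLayerCenterSymmetry
import Summits.Ventures.LatticeQCDFlow.Exactness.KernelCouplingCenterSymmetry

/-!
# The `SU(N)` flow sampler commutes with the global CENTRE transformation when its flow does: from the hot start `E_t[tr P] = 0` at EVERY step — the flow sampler cannot break centre symmetry at any Markov time

HONEST FRAMING: exact (Metropolis-corrected) sampling algorithms for lattice gauge theory;
figures of merit are autocorrelation/cost numbers at stated couplings and volumes; no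
continuum-physics claim.

Venture `LatticeQCDFlow` (cell pub-lqcd), topic `Exactness`; FANOUT row 10 (`eng-equiv`, engine
`latflow.equiv` / `latflow.flows_jax`: flow sampler `equiv/imh.py` / `make_proposer`).  NEW WORK of
the cell; nothing is cited as a fact; no number; no definition is introduced.  Composition of §1 of
`FlowSamplerTranslationCovariance` (`conjKernel_flowSampler_eq_self`), `SUNStoutLayerCenterSymmetry`
(the masked stout layer intertwines `centerTwist z t₀`), `KernelCouplingCenterSymmetry`
(`centerInvariant_jacobian_of_comm`: continuous exact Jacobians of twist-commuting automorphisms are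
centre blind)
and the Literature's centre-symmetry file (`Barriers/QuantumFields/CenterSymmetryBreakingByQuarks`:
`centerTwistEquiv`, `map_centerTwist_pi_haar`, `wilsonAction_centerTwist`,
`integral_eq_zero_of_covariant`, `isCenterCovariant_tracePolyakov`).  Rows 16 / 21 typed the
statement for the HMC arms (`Scoring.HMCKernelCenterSymmetry`, `EngineHMCCenterSymmetry`); this is
the flow sampler's.

## What is typed (every `N`, `d ≥ 1`, `L ≥ 1`, central `z`, slice `t₀`)

* **`conjKernel_flowSampler_centerTwist`**, **`conjKernel_wilsonFlowSampler_centerTwist`** — Wilson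
  target for ANY continuous representation (the action sees plaquettes only), CONTINUOUS exact
  Jacobian (centre blind by `KernelCouplingCenterSymmetry.centerInvariant_jacobian_of_comm`): the only
  hypothesis left is `Ψ(z·V) = z·Ψ(V)`;
* out of equilibrium: `flowModel_map_centerTwist`, **`wilsonFlowSampler_law_map_centerTwist`** (from
  any twist-invariant start the law is twist invariant at every step; the hot start is —
  `map_centerTwist_pi_haar`; the COLD start is not: `tr P = N` there),
  **`integral_wilsonFlowSampler_eq_zero_of_centerCovariant`** (every centre-covariant observable
  with phase `ω ≠ 1` has zero mean at every step), **`integral_wilsonFlowSampler_hotStart_tracePolyakov_eq_zero`**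
  (`N ≥ 2`: `E_t[tr P(y)] = 0` at EVERY step `t`, every base site `y`);
* the `SU(N)` STOUT flow sampler of `SUNStoutFlowSamplerErgodic` with a centre-blind coefficient
  field: **`conjKernel_stoutFlowSampler_centerTwist`**,
  **`integral_stoutFlowSampler_hotStart_tracePolyakov_eq_zero`**, and from the Wilson measure at ANY
  coupling `β₀` (the engine's `β`-bootstrapping start; `wilsonMeasure_map_centerTwist`):
  `integral_stoutFlowSampler_wilsonStart_tracePolyakov_eq_zero`.

NOT here: the cold start; stationarity; `Z_N`-broken phases need infinite volume (nothing claimed); numbers.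
-/

noncomputable section

namespace Summit.Ventures.LatticeQCDFlow.Exactness

open MeasureTheory ProbabilityTheory ProbabilityTheory.Kernel Set
open Literature.MathematicalPhysics.QuantumFieldTheory
open Literature.MathematicalPhysics.QuantumFieldTheory.Luscher2010
open Literature.Barriers.QuantumFields (twistConfig centerTwist centerTwist_apply twistConfig_mem_center
  centerTwistEquiv centerTwistEquiv_apply map_centerTwist_pi_haar wilsonAction_centerTwist
  wilsonMeasure_map_centerTwist integral_eq_zero_of_covariant tracePolyakov isCenterCovariant_tracePolyakov)
open scoped ENNReal Matrix

variable {d L n : ℕ} [NeZero d] [NeZero L] {z : Matrix.specialUnitaryGroup (Fin n) ℂ}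

/-! ## §1 A centre-equivariant flow gives a centre-symmetric flow sampler -/

/-- **The model law `Ψ_* Haar^⊗` of a flow commuting with the twist is twist invariant.** -/
theorem flowModel_map_centerTwist (t₀ : ZMod L)
    {Ψ : GaugeConfig d L (Matrix.specialUnitaryGroup (Fin n) ℂ) → GaugeConfig d L (Matrix.specialUnitaryGroup (Fin n) ℂ)}
    (hΨm : Measurable Ψ) (hΨ : ∀ V, Ψ (centerTwistEquiv z t₀ V) = centerTwistEquiv z t₀ (Ψ V)) :
    ((Measure.pi fun _ : Edge d L => haarProbability (Matrix.specialUnitaryGroup (Fin n) ℂ)).map Ψ).map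
        (centerTwistEquiv z t₀) =
      (Measure.pi fun _ : Edge d L => haarProbability (Matrix.specialUnitaryGroup (Fin n) ℂ)).map Ψ :=
  map_map_eq_self_of_comm hΨm (centerTwistEquiv z t₀) (map_centerTwist_pi_haar z t₀) hΨ

/-- **A flow commuting with the twist gives a twist-symmetric flow sampler** (twist-invariant measurable
target weight `g` and Jacobian `J`). -/
theorem conjKernel_flowSampler_centerTwist (t₀ : ZMod L)
    (Ψ : GaugeConfig d L (Matrix.specialUnitaryGroup (Fin n) ℂ) ≃ᵐ GaugeConfig d L (Matrix.specialUnitaryGroup (Fin n) ℂ))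
    (hΨ : ∀ V, Ψ (centerTwistEquiv z t₀ V) = centerTwistEquiv z t₀ (Ψ V))
    {g J : GaugeConfig d L (Matrix.specialUnitaryGroup (Fin n) ℂ) → ℝ} (hgm : Measurable g) (hJm : Measurable J)
    (hg : ∀ V, g (centerTwist z t₀ V) = g V) (hJ : ∀ V, J (centerTwist z t₀ V) = J V) :
    haveI : IsProbabilityMeasure
        ((Measure.pi fun _ : Edge d L => haarProbability (Matrix.specialUnitaryGroup (Fin n) ℂ)).map Ψ) :=
      Measure.isProbabilityMeasure_map Ψ.measurable.aemeasurable
    conjKernel (indepMH ((Measure.pi fun _ : Edge d L =>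
          haarProbability (Matrix.specialUnitaryGroup (Fin n) ℂ)).map Ψ) (fun U => g U * J (Ψ.symm U)))
        (centerTwistEquiv z t₀) =
      indepMH ((Measure.pi fun _ : Edge d L =>
          haarProbability (Matrix.specialUnitaryGroup (Fin n) ℂ)).map Ψ) (fun U => g U * J (Ψ.symm U)) :=
  conjKernel_flowSampler_eq_self Ψ (centerTwistEquiv z t₀) hgm hJm
    ⟨(centerTwistEquiv z t₀).measurable, map_centerTwist_pi_haar z t₀⟩ hΨ
    (fun V => by rw [centerTwistEquiv_apply, hg]) (fun V => by rw [centerTwistEquiv_apply, hJ])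

/-- **The WILSON flow sampler of a flow commuting with the twist, with a continuous exact Jacobian, is
twist symmetric** — every continuous representation `ρ` (the Wilson action sees plaquettes only:
`wilsonAction_centerTwist`); `J` centre blind by `KernelCouplingCenterSymmetry.centerInvariant_jacobian_of_comm`. -/
theorem conjKernel_wilsonFlowSampler_centerTwist {N : ℕ}
    (hz : z ∈ Subgroup.center (Matrix.specialUnitaryGroup (Fin n) ℂ)) (t₀ : ZMod L)
    (ρ : Matrix.specialUnitaryGroup (Fin n) ℂ →* Matrix (Fin N) (Fin N) ℂ) (hρ : Continuous ρ) (β : ℝ)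
    (Ψ : GaugeConfig d L (Matrix.specialUnitaryGroup (Fin n) ℂ) ≃ᵐ GaugeConfig d L (Matrix.specialUnitaryGroup (Fin n) ℂ))
    (hΨ : ∀ V, Ψ (centerTwistEquiv z t₀ V) = centerTwistEquiv z t₀ (Ψ V))
    {J : GaugeConfig d L (Matrix.specialUnitaryGroup (Fin n) ℂ) → ℝ} (hJc : Continuous J) (hJ0 : ∀ U, 0 ≤ J U)
    (hJac : HasJacobian (Measure.pi fun _ : Edge d L => haarProbability (Matrix.specialUnitaryGroup (Fin n) ℂ)) Ψ
      (fun U => ENNReal.ofReal (J U))) :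
    haveI : IsProbabilityMeasure
        ((Measure.pi fun _ : Edge d L => haarProbability (Matrix.specialUnitaryGroup (Fin n) ℂ)).map Ψ) :=
      Measure.isProbabilityMeasure_map Ψ.measurable.aemeasurable
    conjKernel (indepMH ((Measure.pi fun _ : Edge d L =>
          haarProbability (Matrix.specialUnitaryGroup (Fin n) ℂ)).map Ψ)
        (fun U => Real.exp (-β * wilsonAction ρ U) * J (Ψ.symm U))) (centerTwistEquiv z t₀) =
      indepMH ((Measure.pi fun _ : Edge d L =>
          haarProbability (Matrix.specialUnitaryGroup (Fin n) ℂ)).map Ψ)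
        (fun U => Real.exp (-β * wilsonAction ρ U) * J (Ψ.symm U)) := by
  haveI : SecondCountableTopology (Matrix (Fin n) (Fin n) ℂ) :=
    inferInstanceAs (SecondCountableTopology (Fin n → Fin n → ℂ))
  haveI : SecondCountableTopology (Matrix.specialUnitaryGroup (Fin n) ℂ) :=
    Topology.IsEmbedding.subtypeVal.secondCountableTopology
  obtain ⟨_, -, -, hgm⟩ := wilsonBoltzmann_pinched (d := d) (L := L) ρ hρ β
  exact conjKernel_flowSampler_centerTwist t₀ Ψ hΨ hgm hJc.measurable
    (fun V => by simp only [wilsonAction_centerTwist ρ hz])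
    (centerInvariant_jacobian_of_comm z t₀ Ψ hΨ hJc hJ0 hJac)

/-! ## §2 Out of equilibrium: twist-invariant laws; centre-covariant observables vanish at every step -/

/-- **At every step the law of the Wilson flow-sampler run from a twist-invariant start is twist
invariant** (hot start: `map_centerTwist_pi_haar`; model law: `flowModel_map_centerTwist`). -/
theorem wilsonFlowSampler_law_map_centerTwist {N : ℕ}
    (hz : z ∈ Subgroup.center (Matrix.specialUnitaryGroup (Fin n) ℂ)) (t₀ : ZMod L)
    (ρ : Matrix.specialUnitaryGroup (Fin n) ℂ →* Matrix (Fin N) (Fin N) ℂ) (hρ : Continuous ρ) (β : ℝ)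
    (Ψ : GaugeConfig d L (Matrix.specialUnitaryGroup (Fin n) ℂ) ≃ᵐ GaugeConfig d L (Matrix.specialUnitaryGroup (Fin n) ℂ))
    (hΨ : ∀ V, Ψ (centerTwistEquiv z t₀ V) = centerTwistEquiv z t₀ (Ψ V))
    {J : GaugeConfig d L (Matrix.specialUnitaryGroup (Fin n) ℂ) → ℝ} (hJc : Continuous J) (hJ0 : ∀ U, 0 ≤ J U)
    (hJac : HasJacobian (Measure.pi fun _ : Edge d L => haarProbability (Matrix.specialUnitaryGroup (Fin n) ℂ)) Ψ
      (fun U => ENNReal.ofReal (J U)))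
    {μ₀ : Measure (GaugeConfig d L (Matrix.specialUnitaryGroup (Fin n) ℂ))}
    (hμ₀ : μ₀.map (centerTwistEquiv z t₀) = μ₀) (t : ℕ) :
    haveI : IsProbabilityMeasure
        ((Measure.pi fun _ : Edge d L => haarProbability (Matrix.specialUnitaryGroup (Fin n) ℂ)).map Ψ) :=
      Measure.isProbabilityMeasure_map Ψ.measurable.aemeasurable
    (μ₀.bind (nHit (indepMH ((Measure.pi fun _ : Edge d L =>
          haarProbability (Matrix.specialUnitaryGroup (Fin n) ℂ)).map Ψ)
        (fun U => Real.exp (-β * wilsonAction ρ U) * J (Ψ.symm U))) t)).map (centerTwistEquiv z t₀) =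
      μ₀.bind (nHit (indepMH ((Measure.pi fun _ : Edge d L =>
          haarProbability (Matrix.specialUnitaryGroup (Fin n) ℂ)).map Ψ)
        (fun U => Real.exp (-β * wilsonAction ρ U) * J (Ψ.symm U))) t) :=
  Scoring.map_bind_nHit_eq_self (conjKernel_wilsonFlowSampler_centerTwist hz t₀ ρ hρ β Ψ hΨ hJc hJ0 hJac) hμ₀ t

/-- **Every centre-covariant observable with phase `ω ≠ 1` has zero mean at every step** of the Wilson
flow-sampler run from a twist-invariant start (`F(z·U) = ω F(U)`; no integrability needed). -/
theorem integral_wilsonFlowSampler_eq_zero_of_centerCovariant {N : ℕ}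
    (hz : z ∈ Subgroup.center (Matrix.specialUnitaryGroup (Fin n) ℂ)) (t₀ : ZMod L)
    (ρ : Matrix.specialUnitaryGroup (Fin n) ℂ →* Matrix (Fin N) (Fin N) ℂ) (hρ : Continuous ρ) (β : ℝ)
    (Ψ : GaugeConfig d L (Matrix.specialUnitaryGroup (Fin n) ℂ) ≃ᵐ GaugeConfig d L (Matrix.specialUnitaryGroup (Fin n) ℂ))
    (hΨ : ∀ V, Ψ (centerTwistEquiv z t₀ V) = centerTwistEquiv z t₀ (Ψ V))
    {J : GaugeConfig d L (Matrix.specialUnitaryGroup (Fin n) ℂ) → ℝ} (hJc : Continuous J) (hJ0 : ∀ U, 0 ≤ J U)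
    (hJac : HasJacobian (Measure.pi fun _ : Edge d L => haarProbability (Matrix.specialUnitaryGroup (Fin n) ℂ)) Ψ
      (fun U => ENNReal.ofReal (J U)))
    {μ₀ : Measure (GaugeConfig d L (Matrix.specialUnitaryGroup (Fin n) ℂ))}
    (hμ₀ : μ₀.map (centerTwistEquiv z t₀) = μ₀) (t : ℕ)
    (F : GaugeConfig d L (Matrix.specialUnitaryGroup (Fin n) ℂ) → ℂ) {ω : ℂ} (hω : ω ≠ 1)
    (hF : ∀ U, F (centerTwist z t₀ U) = ω * F U) :
    haveI : IsProbabilityMeasure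
        ((Measure.pi fun _ : Edge d L => haarProbability (Matrix.specialUnitaryGroup (Fin n) ℂ)).map Ψ) :=
      Measure.isProbabilityMeasure_map Ψ.measurable.aemeasurable
    ∫ U, F U ∂(μ₀.bind (nHit (indepMH ((Measure.pi fun _ : Edge d L =>
          haarProbability (Matrix.specialUnitaryGroup (Fin n) ℂ)).map Ψ)
        (fun U => Real.exp (-β * wilsonAction ρ U) * J (Ψ.symm U))) t)) = 0 :=
  integral_eq_zero_of_covariant (centerTwistEquiv z t₀)
    (wilsonFlowSampler_law_map_centerTwist hz t₀ ρ hρ β Ψ hΨ hJc hJ0 hJac hμ₀ t) F hω hF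

/-- **HOT START: `E_t[tr P(y)] = 0` AT EVERY STEP of the Wilson flow-sampler run** (`SU(N)`, `N ≥ 2`,
every base site `y`), for every flow commuting with ALL centre twists of the slice `t₀ = 0`. -/
theorem integral_wilsonFlowSampler_hotStart_tracePolyakov_eq_zero {N : ℕ} (hn : 2 ≤ n)
    (ρ : Matrix.specialUnitaryGroup (Fin n) ℂ →* Matrix (Fin N) (Fin N) ℂ) (hρ : Continuous ρ) (β : ℝ)
    (Ψ : GaugeConfig d L (Matrix.specialUnitaryGroup (Fin n) ℂ) ≃ᵐ GaugeConfig d L (Matrix.specialUnitaryGroup (Fin n) ℂ))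
    (hΨ : ∀ z' : Matrix.specialUnitaryGroup (Fin n) ℂ, z' ∈ Subgroup.center (Matrix.specialUnitaryGroup (Fin n) ℂ) →
      ∀ V, Ψ (centerTwistEquiv z' (0 : ZMod L) V) = centerTwistEquiv z' 0 (Ψ V))
    {J : GaugeConfig d L (Matrix.specialUnitaryGroup (Fin n) ℂ) → ℝ} (hJc : Continuous J) (hJ0 : ∀ U, 0 ≤ J U)
    (hJac : HasJacobian (Measure.pi fun _ : Edge d L => haarProbability (Matrix.specialUnitaryGroup (Fin n) ℂ)) Ψ
      (fun U => ENNReal.ofReal (J U))) (t : ℕ) (y : Site d L) :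
    haveI : IsProbabilityMeasure
        ((Measure.pi fun _ : Edge d L => haarProbability (Matrix.specialUnitaryGroup (Fin n) ℂ)).map Ψ) :=
      Measure.isProbabilityMeasure_map Ψ.measurable.aemeasurable
    ∫ U, tracePolyakov n y U ∂((Measure.pi fun _ : Edge d L => haarProbability (Matrix.specialUnitaryGroup (Fin n) ℂ)).bind
        (nHit (indepMH ((Measure.pi fun _ : Edge d L =>
            haarProbability (Matrix.specialUnitaryGroup (Fin n) ℂ)).map Ψ)
          (fun U => Real.exp (-β * wilsonAction ρ U) * J (Ψ.symm U))) t)) = 0 := by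
  obtain ⟨z', ω, hz', hω, hF⟩ := isCenterCovariant_tracePolyakov (d := d) (L := L) hn y
  exact integral_wilsonFlowSampler_eq_zero_of_centerCovariant hz' 0 ρ hρ β Ψ (hΨ z' hz') hJc hJ0 hJac
    (map_centerTwist_pi_haar z' 0) t (tracePolyakov n y) hω (hF 0)

/-! ## §3 The `SU(N)` stout flow sampler of `SUNStoutFlowSamplerErgodic` -/

section Stout

variable {N : ℕ} (ρW : Matrix.specialUnitaryGroup (Fin n) ℂ →* Matrix (Fin N) (Fin N) ℂ) (hρW : Continuous ρW) (β : ℝ)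
  (p : Edge d L → Prop) [DecidablePred p]
  (ρ : GaugeConfig d L (Matrix.specialUnitaryGroup (Fin n) ℂ) → Edge d L → ℝ)
  (Ψ : GaugeConfig d L (Matrix.specialUnitaryGroup (Fin n) ℂ) ≃ᵐ GaugeConfig d L (Matrix.specialUnitaryGroup (Fin n) ℂ))
  (hΨ : ⇑Ψ = fun (V : GaugeConfig d L (Matrix.specialUnitaryGroup (Fin n) ℂ)) (e : Edge d L) =>
    if p e then
      (⟨NormedSpace.exp ((ρ V e : ℂ) • suProj (plaquetteLoopSum V e.1 e.2)),
          exp_smul_suProj_mem (ρ V e) (plaquetteLoopSum V e.1 e.2)⟩ :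
        Matrix.specialUnitaryGroup (Fin n) ℂ) * V e
    else V e)
  {J : GaugeConfig d L (Matrix.specialUnitaryGroup (Fin n) ℂ) → ℝ} (hJc : Continuous J) (hJ0 : ∀ U, 0 ≤ J U)
  (hJac : HasJacobian (Measure.pi fun _ : Edge d L => haarProbability (Matrix.specialUnitaryGroup (Fin n) ℂ)) Ψ
    (fun U => ENNReal.ofReal (J U)))

include hρW hΨ hJc hJ0 hJac

/-- **The `SU(N)` stout-flow sampler for the Wilson action commutes with the centre transformation**
(every `N`, `d`, `L`; coefficient field centre blind on active links; continuous exact Jacobian). -/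
theorem conjKernel_stoutFlowSampler_centerTwist
    (hz : z ∈ Subgroup.center (Matrix.specialUnitaryGroup (Fin n) ℂ)) (t₀ : ZMod L)
    (hρz : ∀ (V : GaugeConfig d L (Matrix.specialUnitaryGroup (Fin n) ℂ)) (e : Edge d L), p e →
      ρ (centerTwist z t₀ V) e = ρ V e) :
    haveI : IsProbabilityMeasure
        ((Measure.pi fun _ : Edge d L => haarProbability (Matrix.specialUnitaryGroup (Fin n) ℂ)).map Ψ) :=
      Measure.isProbabilityMeasure_map Ψ.measurable.aemeasurable
    conjKernel (indepMH ((Measure.pi fun _ : Edge d L =>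
          haarProbability (Matrix.specialUnitaryGroup (Fin n) ℂ)).map Ψ)
        (fun U => Real.exp (-β * wilsonAction ρW U) * J (Ψ.symm U))) (centerTwistEquiv z t₀) =
      indepMH ((Measure.pi fun _ : Edge d L =>
          haarProbability (Matrix.specialUnitaryGroup (Fin n) ℂ)).map Ψ)
        (fun U => Real.exp (-β * wilsonAction ρW U) * J (Ψ.symm U)) :=
  conjKernel_wilsonFlowSampler_centerTwist hz t₀ ρW hρW β Ψ
    (sunStoutLayer_equiv_centerTwist hz t₀ p ρ hρz Ψ hΨ) hJc hJ0 hJac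

/-- **HOT START: `E_t[tr P(y)] = 0` AT EVERY STEP of the `SU(N)` stout-flow-sampler run** (`N ≥ 2`,
every base site; coefficient field blind to every centre twist of the slice `0`). -/
theorem integral_stoutFlowSampler_hotStart_tracePolyakov_eq_zero (hn : 2 ≤ n)
    (hρz : ∀ z' : Matrix.specialUnitaryGroup (Fin n) ℂ, z' ∈ Subgroup.center (Matrix.specialUnitaryGroup (Fin n) ℂ) →
      ∀ (V : GaugeConfig d L (Matrix.specialUnitaryGroup (Fin n) ℂ)) (e : Edge d L), p e →
        ρ (centerTwist z' (0 : ZMod L) V) e = ρ V e) (t : ℕ) (y : Site d L) :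
    haveI : IsProbabilityMeasure
        ((Measure.pi fun _ : Edge d L => haarProbability (Matrix.specialUnitaryGroup (Fin n) ℂ)).map Ψ) :=
      Measure.isProbabilityMeasure_map Ψ.measurable.aemeasurable
    ∫ U, tracePolyakov n y U ∂((Measure.pi fun _ : Edge d L => haarProbability (Matrix.specialUnitaryGroup (Fin n) ℂ)).bind
        (nHit (indepMH ((Measure.pi fun _ : Edge d L =>
            haarProbability (Matrix.specialUnitaryGroup (Fin n) ℂ)).map Ψ)
          (fun U => Real.exp (-β * wilsonAction ρW U) * J (Ψ.symm U))) t)) = 0 :=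
  integral_wilsonFlowSampler_hotStart_tracePolyakov_eq_zero hn ρW hρW β Ψ
    (fun z' hz' => sunStoutLayer_equiv_centerTwist hz' 0 p ρ (hρz z' hz') Ψ hΨ) hJc hJ0 hJac t y

/-- **β-bootstrap / warm start: `E_t[tr P(y)] = 0` AT EVERY STEP of the `SU(N)` stout-flow-sampler
run started from the Wilson measure at ANY coupling `β₀`** (`N ≥ 2`; the Literature's
`wilsonMeasure_map_centerTwist` supplies the twist-invariant start). -/
theorem integral_stoutFlowSampler_wilsonStart_tracePolyakov_eq_zero (hn : 2 ≤ n) (β₀ : ℝ)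
    (hρz : ∀ z' : Matrix.specialUnitaryGroup (Fin n) ℂ, z' ∈ Subgroup.center (Matrix.specialUnitaryGroup (Fin n) ℂ) →
      ∀ (V : GaugeConfig d L (Matrix.specialUnitaryGroup (Fin n) ℂ)) (e : Edge d L), p e →
        ρ (centerTwist z' (0 : ZMod L) V) e = ρ V e) (t : ℕ) (y : Site d L) :
    haveI : IsProbabilityMeasure
        ((Measure.pi fun _ : Edge d L => haarProbability (Matrix.specialUnitaryGroup (Fin n) ℂ)).map Ψ) :=
      Measure.isProbabilityMeasure_map Ψ.measurable.aemeasurable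
    ∫ U, tracePolyakov n y U ∂((wilsonMeasure (d := d) (L := L) ρW β₀).bind
        (nHit (indepMH ((Measure.pi fun _ : Edge d L =>
            haarProbability (Matrix.specialUnitaryGroup (Fin n) ℂ)).map Ψ)
          (fun U => Real.exp (-β * wilsonAction ρW U) * J (Ψ.symm U))) t)) = 0 := by
  obtain ⟨z', ω, hz', hω, hF⟩ := isCenterCovariant_tracePolyakov (d := d) (L := L) hn y
  exact integral_wilsonFlowSampler_eq_zero_of_centerCovariant hz' 0 ρW hρW β Ψ
    (sunStoutLayer_equiv_centerTwist hz' 0 p ρ (hρz z' hz') Ψ hΨ) hJc hJ0 hJac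
    (wilsonMeasure_map_centerTwist ρW hρW β₀ hz' 0) t (tracePolyakov n y) hω (hF 0)

end Stout

end Summit.Ventures.LatticeQCDFlow.Exactness

end
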